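import Summits.BirchSwinnertonDyer.BirchSwinnertonDyer.Theorems.KatoDescentTamePotSupersingularTameLowerFibreResidualIdentificationBricks
import HarnessLib

/-!
# Route `KatoDescentTamePotSupersingular` (rung K8-t′, cell `bsd-potss`), open core `TameLowerIntrinsicNonCM`
# (item stmt-BirchSwinnertonDyer-19618) — the RESIDUAL IDENTIFICATION behind the Fouquet-2024 fibre roads, file II
# (THE THEOREM): a rank-two Galois representation over a local topological ring whose Frobenius characteristic
# polynomials are residually those of an elliptic curve `W/ℚ` with `ρ̄_{W,p}` onto has — after an integral change
# of basis — a reduction that COVERS `GL₂(𝔽_p)`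
# (a `--supports … --as helper` file; seat `bsd-potss-k8t-c2` generation 18; ROUTE-FREE, NO definitions)

PARTITION (D-0054, cell bsd-potss): EXCLUDED-DOMAIN non-CM additive `p` · B4 (t′) (`e ∈ {3,4,6}`; cell
`(5; II*, v₅(c₄) = 4)` for the fibre roads), `r_an = 0`, LOWER half L₀ — proves-over-readings; closes NONE;
shrinks-literal none; books nothing; BSD is claimed for no curve.

WHAT IS PROVED.  Seat g17's file XXII (`…AdjointBricksFiveCoeffField.lean`, p568821 + p569741) reduced the desk's typed
referee statement T1 `LatticeClause Δ` (bsd-cited r07 S7 §E; Kato's (12.5.2) for a member of the ordinary fibre) for an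
integral ordinary newform datum `Δ : OrdinaryNewformDatum g 5 ι` to ONE displayed binder `hres`: «some `P₀ ∈ GL₂(𝒪)`
conjugates `Δ.ρ` to a representation whose reduction covers `GL₂(𝔽₅)`» — the residual identification
`ρ̄_Δ ≅ ρ̄_W ⊗ k`, which the desk reads (part (a) of its (C1) reading) from «congruence of `a_ℓ` off `pMN_W` +
`Surj W 5`» through Deligne's construction, the Chebotarev density theorem and the Brauer–Nesbitt theorem (g17 memo:
«L/XL, not this lane's»).  But Deligne's construction IS the datum (`OrdinaryNewformDatum.charpoly`: Frobenius
characteristic polynomials `X² − ι(a_ℓ(g))X + ℓ^{k−1}` at `ℓ ∤ Mp`), and the tree PROVES Chebotarev in the existence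
form for every framed representation with open kernel (`FramedGaloisRep.infinite_setOf_isArithFrobAt_apply_eq_of_isOpen_ker`,
`ResidualRepOfCongruentFrobenius.lean`), the Brauer–Nesbitt theorem over an arbitrary field
(`GaloisRepresentations.brauerNesbitt_holds`) and «irreducibility is detected by characteristic polynomials»
(`Semisimple.isIrreducible_of_charpoly_eq`).  This file assembles them, with the bricks of file I, into the ABSTRACT
residual identification `exists_conj_residual_covering_of_frobCharpoly_congr`:

  `S` a local topological ring with OPEN maximal ideal `𝔪 ∋ p`; `ρ : Γ_ℚ →ₜ* GL₂(S)` continuous; `W/ℚ` elliptic in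
  global minimal form with `ρ̄_{W,p}` onto; suppose that off a finite set `T` of finite places, at every place `v` of
  residue characteristic `ℓ ≠ p` of good reduction for `W`, every arithmetic Frobenius at `v` has characteristic
  polynomial `X² − c X + d` under `ρ` with `c ≡ a_ℓ(W)`, `d ≡ ℓ (mod 𝔪)`.  THEN there is `P₀ ∈ GL₂(S)` such that for
  every `q ∈ GL₂(𝔽_p)` some `γ ∈ Γ_ℚ` has `P₀ ρ(γ) P₀⁻¹ ≡ q (mod 𝔪)` entrywise.

Proof: reduce `ρ` to `τ : Γ_ℚ → GL₂(k)`, `k = S/𝔪` (open kernel, as `𝔪` is open); frame `ρ̄_{W,p}` (file I) and push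
it to `τ' : Γ_ℚ → GL₂(k)` along `𝔽_p → k` (`p ∈ 𝔪`); Chebotarev for the PAIR `(τ, τ')` (one continuous homomorphism
into `GL₂(k × k)` with open kernel, `exists_monoidHom_prod_entries`) moves every `σ ∈ Γ_ℚ` to an arithmetic Frobenius
`Φ` above a large good prime `ℓ ∉ T`, where both characteristic polynomials are `X² − ā_ℓ X + ℓ̄`; so `τ, τ'` have the
same characteristic polynomials everywhere; `τ'` is irreducible (its image contains both elementary transvections),
hence so is `τ` (`isIrreducible_of_charpoly_eq`), both are semisimple and Brauer–Nesbitt makes them equivalent, i.e.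
conjugate by some `Q ∈ GL₂(k)` (file I); lift `Q` to `P₀ ∈ GL₂(S)`.  The sequel file instantiates
`S = 𝒪 = padicCoeffIntegers ι`, `ρ = Δ.ρ` (the datum's Frobenius data + a trace congruence with `W`) and feeds XXII.

HONEST LABEL.  Pure Galois-representation theory over the tree's PROVED Chebotarev and Brauer–Nesbitt theorems; nothing
about items 19618/19981 (open: Kato's Conj. 12.10 lower inclusion at an additive potentially supersingular prime),
which stay OPEN.  No definition, no named fact, no `sorry`; axioms `propext`, `Classical.choice`, `Quot.sound`.

References: [DarmonDiamondTaylor1995] Thm. 2.3 (Chebotarev), Prop. 2.6 (b) (Brauer–Nesbitt form), Prop. 2.8 (a),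
Prop. 2.11 (a) (PDF pp. 52–57); [DeligneSerreASENS1974] 6.7, §8.6; [BourbakiAlgebreVIII2012] VIII §20 n°6 Thm. 2 Cor. 1;
[TateGCFT1967] §2.4; [Serre1981] §8.1 (238); [SilvermanAEC2009] III.§7; [EmertonPollackWeston2006] §3.1 (the datum);
[Kato2004Asterisque] (12.5.2), Thm. 14.5; [Fouquet2024CongruencesIMC] Thm. 1.1, Prop. 3.9.
-/

set_option autoImplicit false
-- sibling precedent (the `…FibreAdjointBricksFive*` family): the directory name repeats the summit name
set_option linter.dupNamespace false

noncomputable section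

open scoped MatrixGroups NumberField Polynomial
open Matrix IsLocalRing Field IsDedekindDomain NumberField Polynomial WeierstrassCurve
open Literature.NumberTheory.GaloisRepresentations Literature.NumberTheory.EllipticCurves
  Literature.RepresentationTheory.Semisimple


namespace Summit.BirchSwinnertonDyer.BirchSwinnertonDyer.Theorems.FibreResidualIdentification

universe u v

/-! ## §3 The residual identification: a conjugate of `ρ` reduces onto `GL₂(𝔽_p)` -/

section Main

variable {S : Type u} [CommRing S] [IsLocalRing S] [TopologicalSpace S] [IsTopologicalRing S]

/-- **THE RESIDUAL IDENTIFICATION.**  Let `S` be a local topological ring with open maximal ideal `𝔪 ∋ p`,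
`ρ : Γ_ℚ →ₜ* GL₂(S)` continuous, `W/ℚ` an elliptic curve in global minimal form with `ρ̄_{W,p}` ONTO, and
suppose that off a finite set `T` of finite places, at every place `v` of residue characteristic `ℓ ≠ p` of good
reduction for `W`, every arithmetic Frobenius has characteristic polynomial `X² − c X + d` under `ρ` with
`c ≡ a_ℓ(W)`, `d ≡ ℓ (mod 𝔪)`.  Then some `P₀ ∈ GL₂(S)` has: for every `q ∈ GL₂(𝔽_p)` there is `γ ∈ Γ_ℚ` with
`P₀ ρ(γ) P₀⁻¹ ≡ q (mod 𝔪)` entrywise — the reduction of `P₀ ρ P₀⁻¹` COVERS `GL₂(𝔽_p)` (indeed equals the frame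
of `ρ̄_{W,p}` pushed to `S/𝔪`).  Chebotarev for the pair (tree theorem
`FramedGaloisRep.infinite_setOf_isArithFrobAt_apply_eq_of_isOpen_ker`) + Brauer–Nesbitt (`brauerNesbitt_holds`) +
«charpolys detect irreducibility» (`isIrreducible_of_charpoly_eq`).
[cite: DarmonDiamondTaylor1995, Thm. 2.3, Prop. 2.6 (b) (PDF pp. 52–54)] [cite: DeligneSerreASENS1974, 6.7 and §8.6]
[cite: BourbakiAlgebreVIII2012, VIII § 20 n° 6, Thm. 2, Cor. 1 (p. 378)] -/
theorem exists_conj_residual_covering_of_frobCharpoly_congr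
    (h𝔪 : IsOpen ((maximalIdeal S : Ideal S) : Set S)) (p : ℕ) [Fact p.Prime]
    (hp : (p : S) ∈ maximalIdeal S) (ρ : FramedGaloisRep ℚ S 2)
    (W : WeierstrassCurve ℚ) [W.IsElliptic] [W.IsGloballyMinimal] (hsurj : W.HasSurjectiveModNGaloisRep p)
    (T : Set (HeightOneSpectrum (𝓞 ℚ))) (hT : T.Finite)
    (hfrob : ∀ v ∉ T, ∀ (ℓ : ℕ) [Fact ℓ.Prime], (ℓ : 𝓞 ℚ) ∈ v.asIdeal → ℓ ≠ p → W.HasGoodReductionAtPrime ℓ →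
      ∃ c d : S, ρ.HasFrobCharpolyAt v (X ^ 2 - C c * X + C d) ∧
        c - ((W.frobeniusTrace ℓ : ℤ) : S) ∈ maximalIdeal S ∧ d - (ℓ : S) ∈ maximalIdeal S) :
    ∃ P₀ : GL (Fin 2) S, ∀ q : GL (Fin 2) (ZMod p), ∃ γ : absoluteGaloisGroup ℚ, ∀ i j,
      (P₀ * ρ γ * P₀⁻¹).val i j - (((q.val i j).val : ℕ) : S) ∈ maximalIdeal S := by
  classical
  letI : Module (ZMod p) (W.geomTorsion p) := AddSubgroup.torsionBy.zmodModule
  have hpp : p.Prime := Fact.out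
  -- the residue field `k`, of characteristic `p`, and `f : 𝔽_p → k`
  set k := ResidueField S with hk
  haveI : CharP k p := by
    refine (CharP.charP_iff_prime_eq_zero hpp).mpr ?_
    rw [← map_natCast (residue S), residue_eq_zero_iff]
    exact hp
  let f : ZMod p →+* k := ZMod.castHom (dvd_refl p) k
  -- an `𝔽_p`-basis of `W[p]` and the frame `φ` of `ρ̄_{W,p}`
  haveI : Finite (W.geomTorsion p) :=
    finite_torsionPoints_holds W (AlgebraicClosure ℚ) (n := p) (by exact_mod_cast hpp.ne_zero)
  haveI : Module.Finite (ZMod p) (W.geomTorsion p) := Module.Finite.of_finite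
  have h2 : Module.finrank (ZMod p) (W.geomTorsion p) = 2 :=
    Literature.RepresentationTheory.FiniteGroups.Representation.finrank_eq_two_of_natCard_eq_sq
      (card_torsionPoints_eq_sq_holds W (AlgebraicClosure ℚ) (n := p)
        (by exact_mod_cast hpp.ne_zero))
  let b : Module.Basis (Fin 2) (ZMod p) (W.geomTorsion p) := Module.finBasisOfFinrankEq _ _ h2
  obtain ⟨φ, hφ⟩ := exists_framed_galoisRepTorsionLin W p b
  -- the two reductions `τ = ρ mod 𝔪` and `τ' = f ∘ φ`
  let τ : absoluteGaloisGroup ℚ →* GL (Fin 2) k := (Matrix.GeneralLinearGroup.map (residue S)).comp ρ.toMonoidHom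
  let τ' : absoluteGaloisGroup ℚ →* GL (Fin 2) k := (Matrix.GeneralLinearGroup.map f).comp φ
  have hτval : ∀ g, ((τ g : GL (Fin 2) k) : Matrix (Fin 2) (Fin 2) k) =
      ((ρ g : GL (Fin 2) S) : Matrix (Fin 2) (Fin 2) S).map (residue S) := fun g ↦ rfl
  have hτ'val : ∀ g, ((τ' g : GL (Fin 2) k) : Matrix (Fin 2) (Fin 2) k) =
      ((φ g : GL (Fin 2) (ZMod p)) : Matrix (Fin 2) (Fin 2) (ZMod p)).map f := fun g ↦ rfl
  -- both have open kernel
  have hτker : IsOpen (τ.ker : Set (absoluteGaloisGroup ℚ)) := by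
    have hcont : Continuous fun g : absoluteGaloisGroup ℚ ↦ ((ρ g : GL (Fin 2) S) : Matrix (Fin 2) (Fin 2) S) :=
      Units.continuous_val.comp (map_continuous ρ)
    have hset : (τ.ker : Set (absoluteGaloisGroup ℚ)) =
        ⋂ i : Fin 2, ⋂ j : Fin 2, (fun g : absoluteGaloisGroup ℚ ↦
          ((ρ g : GL (Fin 2) S) : Matrix (Fin 2) (Fin 2) S) i j) ⁻¹'
            {x : S | x - (1 : Matrix (Fin 2) (Fin 2) S) i j ∈ maximalIdeal S} := by
      ext g
      simp only [SetLike.mem_coe, MonoidHom.mem_ker, Set.mem_iInter, Set.mem_preimage, Set.mem_setOf_eq]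
      constructor
      · intro hg i j
        have hij := congrArg (fun R : GL (Fin 2) k ↦ (R : Matrix (Fin 2) (Fin 2) k) i j) hg
        simp only [hτval, Matrix.map_apply, Units.val_one] at hij
        rw [← residue_eq_residue_iff]
        rw [hij]
        rcases eq_or_ne i j with rfl | hne
        · rw [Matrix.one_apply_eq, Matrix.one_apply_eq, map_one]
        · rw [Matrix.one_apply_ne hne, Matrix.one_apply_ne hne, map_zero]
      · intro hg
        refine Units.ext (Matrix.ext fun i j ↦ ?_)
        rw [hτval, Matrix.map_apply, Units.val_one]
        have hij := (residue_eq_residue_iff _ _).mpr (hg i j)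
        rw [hij]
        rcases eq_or_ne i j with rfl | hne
        · rw [Matrix.one_apply_eq, Matrix.one_apply_eq, map_one]
        · rw [Matrix.one_apply_ne hne, Matrix.one_apply_ne hne, map_zero]
    rw [hset]
    refine isOpen_iInter_of_finite fun i ↦ isOpen_iInter_of_finite fun j ↦ ?_
    refine IsOpen.preimage ((continuous_apply j).comp ((continuous_apply i).comp hcont)) ?_
    exact h𝔪.preimage (continuous_id.sub continuous_const)
  have hτ'ker : IsOpen (τ'.ker : Set (absoluteGaloisGroup ℚ)) := by
    obtain ⟨K, hK, hKφ⟩ := exists_isOpen_subgroup_le_ker_framed b hφ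
    refine Subgroup.isOpen_mono (H₁ := K) (fun κ hκ ↦ ?_) hK
    rw [MonoidHom.mem_ker]
    change Matrix.GeneralLinearGroup.map f (φ κ) = 1
    rw [hKφ κ hκ, map_one]
  -- the pair `(τ, τ')` as ONE continuous homomorphism into `GL₂(k × k)` (discrete topology)
  obtain ⟨π, hπ1, hπ2, hπker⟩ := exists_monoidHom_prod_entries τ τ'
  have hπopen : IsOpen (π.ker : Set (absoluteGaloisGroup ℚ)) := by
    rw [hπker, Subgroup.coe_inf]
    exact hτker.inter hτ'ker
  letI : TopologicalSpace (k × k) := ⊥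
  haveI : DiscreteTopology (k × k) := ⟨rfl⟩
  haveI : ContinuousAdd (k × k) := ⟨continuous_of_discreteTopology⟩
  haveI : ContinuousMul (k × k) := ⟨continuous_of_discreteTopology⟩
  let ψ : FramedGaloisRep ℚ (k × k) 2 :=
    ⟨π, continuous_of_isOpen_subgroup_le_ker π π.ker hπopen fun x hx ↦ hx⟩
  have hψker : IsOpen (ψ.toMonoidHom.ker : Set (absoluteGaloisGroup ℚ)) := hπopen
  -- the finite set of bad places: `T`, the places above `p`, the places of bad reduction
  have hΔ : W.minimalDiscriminantInt ≠ 0 := minimalDiscriminantInt_ne_zero W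
  let Sbad : Set ℕ := {ℓ | ℓ ≤ max p (W.minimalDiscriminantInt).natAbs}
  have hSbad : Sbad.Finite := Set.finite_le_nat _
  let B : Set (HeightOneSpectrum (𝓞 ℚ)) :=
    T ∪ ⋃ ℓ ∈ {ℓ ∈ Sbad | ℓ ≠ 0}, {v : HeightOneSpectrum (𝓞 ℚ) | (ℓ : 𝓞 ℚ) ∈ v.asIdeal}
  have hB : B.Finite := hT.union (finite_setOf_place_over Sbad hSbad)
  -- equal characteristic polynomials of `τ σ` and `τ' σ` for EVERY `σ`
  have hcp : ∀ σ : absoluteGaloisGroup ℚ,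
      ((τ σ : GL (Fin 2) k) : Matrix (Fin 2) (Fin 2) k).charpoly =
        ((τ' σ : GL (Fin 2) k) : Matrix (Fin 2) (Fin 2) k).charpoly := by
    intro σ
    obtain ⟨v, ⟨-, 𝔓, h𝔓, Φ, hΦ, hπΦ⟩, hvB⟩ :=
      ((ψ.infinite_setOf_isArithFrobAt_apply_eq_of_isOpen_ker hψker σ).sdiff hB).nonempty
    have hπΦ' : π Φ = π σ := hπΦ
    have hτΦ : τ Φ = τ σ := by
      refine Units.ext ?_
      rw [← hπ1 Φ, ← hπ1 σ, hπΦ']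
    have hτ'Φ : τ' Φ = τ' σ := by
      refine Units.ext ?_
      rw [← hπ2 Φ, ← hπ2 σ, hπΦ']
    -- the residue characteristic `ℓ` of `v`: a large good prime `≠ p`
    have hvT : v ∉ T := fun h ↦ hvB (Or.inl h)
    obtain ⟨ℓ, hℓ, hℓv⟩ := exists_prime_natCast_mem v
    haveI : Fact ℓ.Prime := ⟨hℓ⟩
    have hℓS : ℓ ∉ Sbad := fun hmem ↦
      hvB (Or.inr (Set.mem_biUnion (x := ℓ) ⟨hmem, hℓ.ne_zero⟩ hℓv))
    have hℓgt : max p (W.minimalDiscriminantInt).natAbs < ℓ := not_le.mp hℓS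
    have hℓp : ℓ ≠ p := by
      have := le_max_left p (W.minimalDiscriminantInt).natAbs
      omega
    have hℓΔ : ¬ (ℓ : ℤ) ∣ W.minimalDiscriminantInt := fun h ↦ by
      have h1 := Nat.le_of_dvd (Int.natAbs_pos.mpr hΔ) (Int.natCast_dvd.mp h)
      have h2 := le_max_right p (W.minimalDiscriminantInt).natAbs
      omega
    have hgood : W.HasGoodReductionAtPrime ℓ := hasGoodReductionAtPrime_of_not_dvd W ℓ hℓΔ
    have hvℓ : (Rat.HeightOneSpectrum.primesEquiv v : ℕ) = ℓ := primesEquiv_eq_of_natCast_mem hℓ hℓv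
    -- `charpoly (τ Φ) = X² − ā X + ℓ̄`
    obtain ⟨c, d, hcd, hc, hd⟩ := hfrob v hvT ℓ hℓv hℓp hgood
    have e1 : ((τ Φ : GL (Fin 2) k) : Matrix (Fin 2) (Fin 2) k).charpoly =
        X ^ 2 - C ((W.frobeniusTrace ℓ : ℤ) : k) * X + C ((ℓ : ℕ) : k) := by
      rw [hτval, Matrix.charpoly_map]
      have hρΦ : ((ρ Φ : GL (Fin 2) S) : Matrix (Fin 2) (Fin 2) S).charpoly = X ^ 2 - C c * X + C d :=
        hcd 𝔓 h𝔓 Φ hΦ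
      rw [hρΦ]
      have hc' : residue S c = ((W.frobeniusTrace ℓ : ℤ) : k) := by
        rw [← map_intCast (residue S), residue_eq_residue_iff]; exact hc
      have hd' : residue S d = ((ℓ : ℕ) : k) := by
        rw [← map_natCast (residue S), residue_eq_residue_iff]; exact hd
      simp only [Polynomial.map_add, Polynomial.map_sub, Polynomial.map_mul, Polynomial.map_pow,
        Polynomial.map_X, Polynomial.map_C, hc', hd']
    -- `charpoly (τ' Φ) = X² − ā X + ℓ̄`
    have e2 : ((τ' Φ : GL (Fin 2) k) : Matrix (Fin 2) (Fin 2) k).charpoly =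
        X ^ 2 - C ((W.frobeniusTrace ℓ : ℤ) : k) * X + C ((ℓ : ℕ) : k) := by
      rw [hτ'val, Matrix.charpoly_map, charpoly_framed_frobenius_eq hℓp hgood hvℓ h𝔓 hΦ b hφ]
      simp only [Polynomial.map_add, Polynomial.map_sub, Polynomial.map_mul, Polynomial.map_pow,
        Polynomial.map_X, Polynomial.map_C]
      rw [map_intCast f, map_natCast f]
    rw [← hτΦ, ← hτ'Φ, e1, e2]
  -- `τ'` is irreducible: its image contains the two elementary transvections
  have hirr' : (glRepresentation τ').IsIrreducible := by
    let u₁ : SL(2, ZMod p) := ⟨!![1, 1; 0, 1], by simp [Matrix.det_fin_two_of]⟩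
    let u₂ : SL(2, ZMod p) := ⟨!![1, 0; 1, 1], by simp [Matrix.det_fin_two_of]⟩
    obtain ⟨γ₁, hγ₁⟩ := exists_apply_eq_of_hasSurjectiveModNGaloisRep hsurj b hφ (Matrix.SpecialLinearGroup.toGL u₁)
    obtain ⟨γ₂, hγ₂⟩ := exists_apply_eq_of_hasSurjectiveModNGaloisRep hsurj b hφ (Matrix.SpecialLinearGroup.toGL u₂)
    refine isIrreducible_of_transvections_mem_range τ' ⟨γ₁, ?_⟩ ⟨γ₂, ?_⟩
    · rw [hτ'val, hγ₁, Matrix.SpecialLinearGroup.coe_GL_coe_matrix]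
      ext i j
      fin_cases i <;> fin_cases j <;> simp [u₁]
    · rw [hτ'val, hγ₂, Matrix.SpecialLinearGroup.coe_GL_coe_matrix]
      ext i j
      fin_cases i <;> fin_cases j <;> simp [u₂]
  -- hence `τ` is irreducible, both are semisimple, and Brauer–Nesbitt makes them equivalent
  have hirr : (glRepresentation τ).IsIrreducible := isIrreducible_of_charpoly_eq τ τ' hcp hirr'
  haveI := hirr
  haveI := hirr'
  have hss : (glRepresentation τ).IsSemisimpleRepresentation := inferInstance
  have hss' : (glRepresentation τ').IsSemisimpleRepresentation := inferInstance
  obtain ⟨e⟩ : Nonempty ((glRepresentation τ).Equiv (glRepresentation τ')) := by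
    refine brauerNesbitt_holds (glRepresentation τ) (glRepresentation τ') hss hss' fun g ↦ ?_
    have eτ : (glRepresentation τ g : (Fin 2 → k) →ₗ[k] (Fin 2 → k)) =
        Matrix.toLin' ((τ g : GL (Fin 2) k) : Matrix (Fin 2) (Fin 2) k) :=
      LinearMap.ext fun w ↦ by rw [Matrix.toLin'_apply]; rfl
    have eτ' : (glRepresentation τ' g : (Fin 2 → k) →ₗ[k] (Fin 2 → k)) =
        Matrix.toLin' ((τ' g : GL (Fin 2) k) : Matrix (Fin 2) (Fin 2) k) :=
      LinearMap.ext fun w ↦ by rw [Matrix.toLin'_apply]; rfl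
    rw [eτ, eτ', Matrix.charpoly_toLin', Matrix.charpoly_toLin']
    exact hcp g
  -- `τ' = Q τ Q⁻¹`; lift `Q` to `P₀ ∈ GL₂(S)`
  obtain ⟨Q, hQ⟩ := exists_conj_of_equiv_glRepresentation τ τ' e
  obtain ⟨P₀, hP₀⟩ := exists_generalLinearGroup_map_residue_eq Q
  refine ⟨P₀, fun q ↦ ?_⟩
  obtain ⟨γ, hγ⟩ := exists_apply_eq_of_hasSurjectiveModNGaloisRep hsurj b hφ q
  refine ⟨γ, fun i j ↦ ?_⟩
  -- `P₀ ρ γ P₀⁻¹ mod 𝔪 = Q τ γ Q⁻¹ = τ' γ = f q`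
  have hred : Matrix.GeneralLinearGroup.map (residue S) (P₀ * ρ γ * P₀⁻¹) =
      Matrix.GeneralLinearGroup.map f q := by
    rw [map_mul, map_mul, map_inv, hP₀, ← hγ]
    exact (hQ γ).symm
  have hij := (generalLinearGroup_map_eq_iff (residue S) _ _).mp hred i j
  rw [← residue_eq_residue_iff, map_natCast, hij]
  change f (q.val i j) = _
  rw [ZMod.castHom_apply, ZMod.cast_eq_val]

end Main

end Summit.BirchSwinnertonDyer.BirchSwinnertonDyer.Theorems.FibreResidualIdentification

end
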